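import Mathlib.Data.Nat.Log
import Mathlib.Algebra.BigOperators.Fin
import Mathlib.Tactic.Ring
import Mathlib.Tactic.Linarith
import Mathlib.Tactic.Positivity
import Literature.Computability.Complexity.SliceFunctions
import Literature.Computability.Complexity.OddEvenMerge
import HarnessLib

/-!
# All pseudo-complements by one monotone circuit of size `O(n log² n)`
# (Wegener 1987, Ch. 6, Thm. 13.3): discharge of `pseudoComplements_cktSize`

This file DISCHARGES the named fact
`Literature.Computability.Complexity.pseudoComplements_cktSize` of `SliceFunctions.lean`
(Paterson, unpublished; Wegener 1985; Valiant 1986 — as stated without proof by Jukna 2012,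
§10.1.1, p. 300): *all `n` pseudo-complements `Th_k(x - xᵢ)`, `i = 1, …, n`, are computed
simultaneously by a monotone circuit with `O(n log² n)` gates* — here, in the tree's model, by
one straight-line program over `monotoneBasis01 = {∧₂, ∨₂, 0, 1}` with at most
`64 · n · ⌊log₂ n⌋²` gates for every `n ≥ 2` and every `k` (`pseudoComplements_cktSize_holds`).
Everything in this file is PROVED (no named facts, no definitions: the networks are produced as
witnesses of existential statements together with their specifications). Batcher's odd–even
merging network is `exists_oddEvenMerge` of `OddEvenMerge.lean`.

## The printed proof (Wegener 1987, Ch. 6, Thm. 13.3, `C_m(k) = O(n min{k, n-k, log² n})`,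
## the case "`k` not too small and not too large") and its rendering here

W.l.o.g. `n = 2ᵐ`; for `r ≤ m` the variables split into `2^{m-r}` blocks of `2ʳ` consecutive
variables.

1. *Sort all blocks* with a Batcher sorting network, `O(n log² n)` gates (Wegener 1987, Ch. 6,
   §2, Alg. 2.1 and Thm. 2.1). On `0`–`1` inputs a sorted block is the unary code
   `s ↦ [s < |block|]` of its number of ones, and Batcher's odd–even *merge* of two sorted
   `0`–`1` sequences is unary addition (`exists_oddEvenMerge`, `(p+1) 2^{p+1}` gates for two
   codes of length `2ᵖ`). Here: the network `S` of `exists_sliceNetworks` (all levels of sorted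
   blocks, merge sort level by level, `p² 2ᵖ` gates on `2ᵖ` inputs).
2. *Walk down.* `Xᵢ = X - {xᵢ}` is the disjoint union of one block `Z_{i,r}` of each level
   `r < m`; with `Y_{i,r} = Z_{i,m-1} ∪ … ∪ Z_{i,r}` (the complement of the level-`r` block
   containing `xᵢ`), "it suffices to know the elements of rank `k - 2^{r+1} + 1, …, k` in
   `Y_{i,r+1}`": merging them with the sorted block `Z_{i,r}` (a Batcher merge,
   `O((r+1) 2^{r+1})` gates) gives the elements of rank `k - 2ʳ + 1, …, k` of `Y_{i,r}`, and at
   `r = 0` the single bit `Th_k(x - xᵢ) = Th_k(Y_{i,0})`; `2^{m-r}` merges per level, hence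
   `O((r+1) n)` gates per level and `O(n m²) = O(n log² n)` in total. Here: the network `T` of
   `exists_sliceNetworks` (`(2p² + 7p) 2ᵖ` gates), whose input is the rank window of the
   complement written as the antitone vector `j ↦ [α ≤ j]` (`α = k - #ones outside`, clamped to
   `[0, 2ᵖ]`) together with the sorted blocks of all lower levels, and whose specification is
   `T(…)ᵢ = [α ≤ |x - xᵢ|]`; the window of a child block is read off (reversed) from the merge
   of the reversed parent window with the (zero-padded) sorted sibling block.
3. *Assembly* (`pseudoComplements_cktSize_pow`): the root window `j ↦ [k ≤ j]` consists of
   constants (two gates), so `2ᵈ` variables cost `(3d² + 7d) 2ᵈ + 2` gates; a general `n ≥ 2` is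
   padded with constant zeros to `2ᵈ` variables, `d = ⌊log₂ n⌋ + 1 ≤ 2 log₂ n`, `2ᵈ ≤ 2n`
   (`card_ne_pad`, `pseudoComplements_size_le`, `pseudoComplements_cktSize_holds`).

Sizes count ALL gates (`CktSize`, `CircuitComposition.lean`), constants included; the two
constant gates and the `min{k, n-k}` alternatives of Thm. 13.3 are irrelevant for the `O(·)`.
Theorem 10.1 of Jukna (Berkowitz) then follows by
`berkowitz_sliceMonotonization_of_pseudoComplements_cktSize` (`SliceFunctionsProofs.lean`).

## References

* I. Wegener, *The Complexity of Boolean Functions*, Wiley–Teubner (1987), Ch. 6, §2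
  (Batcher's merging and sorting networks: Algorithm 2.1, eqs. (2.2)–(2.7), Thm. 2.1) and
  Ch. 6, §13 ("Negation is powerless for slice functions"), Thm. 13.3 and its proof
  [Wegener1987].
* I. Wegener, *On the complexity of slice functions*, Theoret. Comput. Sci. 38 (1985) 55–68
  [Wegener1985].
* L. G. Valiant, *Negation is powerless for Boolean slice functions*, SIAM J. Comput. 15
  (1986) 531–535 [Valiant1986].
* S. Jukna, *Boolean Function Complexity: Advances and Frontiers*, Springer (2012), §10.1.1,
  p. 300 (the statement, attributed to Paterson, Wegener and Valiant) [Jukna2012].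
* H. Vollmer, *Introduction to Circuit Complexity* (1999), §1.2 (composition of circuits)
  [Vollmer1999].
-/

namespace Literature.Computability.Complexity

open Finset GateList

/-! ### Cells over the monotone basis with constants `{∧₂, ∨₂, 0, 1}` -/

/-- The constant gates are in `{∧₂, ∨₂, 0, 1}`. [folklore] -/
theorem const_mem_monotoneBasis01 (b : Bool) : GateFn.const b ∈ monotoneBasis01 := by
  cases b
  · exact Set.mem_insert_of_mem _ (Set.mem_insert _ _)
  · exact Set.mem_insert _ _

/-- A constant costs one (fan-in `0`) gate over `{∧₂, ∨₂, 0, 1}`. [folklore] -/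
theorem cktSize_const_mono01 (ι : Type*) (b : Bool) :
    CktSize monotoneBasis01 (fun (_ : ι → Bool) (_ : Unit) => b) 1 :=
  (CktSize.gate (B := monotoneBasis01) (ι := ι) (GateFn.const b) (const_mem_monotoneBasis01 b)
    Fin.elim0).congr fun _ _ => rfl

/-- Both constants at once, as the map `x ↦ (b ↦ b)`: two gates over `{∧₂, ∨₂, 0, 1}`.
[folklore] -/
theorem cktSize_consts_mono01 (ι : Type*) :
    CktSize monotoneBasis01 (fun (_ : ι → Bool) (b : Bool) => b) 2 :=
  (((cktSize_const_mono01 ι true).pair (cktSize_const_mono01 ι false)).outMap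
    fun b : Bool => if b then Sum.inl () else Sum.inr ()).congr fun _ b => by cases b <;> rfl

/-! ### Counting lemmas -/

/-- `|x| ≤ n` for `x ∈ {0,1}ⁿ`. [folklore] -/
theorem hammingWeight_le {n : ℕ} (x : Fin n → Bool) : hammingWeight x ≤ n :=
  (card_filter_le _ _).trans (by simp)

/-- The number of ones of `x` off the coordinate `i` is `< n`. [folklore] -/
theorem card_ne_lt {n : ℕ} (x : Fin n → Bool) (i : Fin n) :
    (univ.filter fun j => j ≠ i ∧ x j = true).card < n := by
  calc (univ.filter fun j => j ≠ i ∧ x j = true).card ≤ (univ.erase i).card :=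
        card_le_card fun j hj => by
          simp only [mem_filter, mem_univ, true_and] at hj
          exact mem_erase.2 ⟨hj.1, mem_univ _⟩
    _ = n - 1 := by rw [card_erase_of_mem (mem_univ i), card_univ, Fintype.card_fin]
    _ < n := Nat.sub_lt (Fin.pos i) one_pos

/-- `|x| = |x - xᵢ| + xᵢ`. [folklore] -/
theorem hammingWeight_eq_card_ne_add {n : ℕ} (x : Fin n → Bool) (i : Fin n) :
    hammingWeight x =
      (univ.filter fun j => j ≠ i ∧ x j = true).card + (if x i = true then 1 else 0) := by
  classical
  unfold hammingWeight
  have : (univ.filter fun j => x j = true) =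
      (univ.filter fun j => j ≠ i ∧ x j = true) ∪ (if x i = true then {i} else ∅) := by
    ext j
    by_cases hji : j = i
    · subst hji; by_cases h : x j = true <;> simp [h]
    · by_cases h : x j = true <;> by_cases hi : x i = true <;> simp [h, hji, hi]
  rw [this, card_union_of_disjoint]
  · by_cases h : x i = true <;> simp [h]
  · by_cases h : x i = true
    · simp [h]
    · simp [h]

/-- Splitting a sum over `Fin (a + b)` (with the two halves addressed by value). [folklore] -/
theorem sum_fin_split {a b c : ℕ} (h : a + b = c) (f : Fin c → ℕ) :
    ∑ j : Fin c, f j =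
      ∑ j : Fin a, f ⟨j, by omega⟩ + ∑ j : Fin b, f ⟨a + j, by omega⟩ := by
  subst h
  rw [Fin.sum_univ_add]
  rfl

/-- `|x| = |x_L| + |x_R|` for the two halves of `x ∈ {0,1}^{2^{p+1}}`. [folklore] -/
theorem hammingWeight_halves (p : ℕ) (x : Fin (2 ^ (p + 1)) → Bool)
    (hl : ∀ j : Fin (2 ^ p), (j : ℕ) < 2 ^ (p + 1))
    (hr : ∀ j : Fin (2 ^ p), 2 ^ p + (j : ℕ) < 2 ^ (p + 1)) :
    hammingWeight x = hammingWeight (fun j : Fin (2 ^ p) => x ⟨j, hl j⟩) +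
      hammingWeight (fun j : Fin (2 ^ p) => x ⟨2 ^ p + j, hr j⟩) := by
  unfold hammingWeight
  rw [card_filter, card_filter, card_filter,
    sum_fin_split (show 2 ^ p + 2 ^ p = 2 ^ (p + 1) by ring) fun j => if x j = true then 1 else 0]

/-- `|x - xᵢ| = |x_L - xᵢ| + |x_R|` for `i` in the left half. [folklore] -/
theorem card_ne_halves_left (p : ℕ) (x : Fin (2 ^ (p + 1)) → Bool)
    (hl : ∀ j : Fin (2 ^ p), (j : ℕ) < 2 ^ (p + 1))
    (hr : ∀ j : Fin (2 ^ p), 2 ^ p + (j : ℕ) < 2 ^ (p + 1))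
    (i : Fin (2 ^ (p + 1))) (hi : (i : ℕ) < 2 ^ p) :
    (univ.filter fun j => j ≠ i ∧ x j = true).card =
      (univ.filter fun j : Fin (2 ^ p) => j ≠ ⟨i, hi⟩ ∧ x ⟨j, hl j⟩ = true).card +
        hammingWeight (fun j : Fin (2 ^ p) => x ⟨2 ^ p + j, hr j⟩) := by
  have e0 := hammingWeight_eq_card_ne_add x i
  have e1 := hammingWeight_eq_card_ne_add (fun j : Fin (2 ^ p) => x ⟨j, hl j⟩) ⟨i, hi⟩
  have e2 := hammingWeight_halves p x hl hr
  simp only [Fin.eta] at e1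
  omega

/-- `|x - xᵢ| = |x_L| + |x_R - xᵢ|` for `i` in the right half. [folklore] -/
theorem card_ne_halves_right (p : ℕ) (x : Fin (2 ^ (p + 1)) → Bool)
    (hl : ∀ j : Fin (2 ^ p), (j : ℕ) < 2 ^ (p + 1))
    (hr : ∀ j : Fin (2 ^ p), 2 ^ p + (j : ℕ) < 2 ^ (p + 1))
    (i : Fin (2 ^ (p + 1))) (hi : ¬ (i : ℕ) < 2 ^ p) (hi' : (i : ℕ) - 2 ^ p < 2 ^ p) :
    (univ.filter fun j => j ≠ i ∧ x j = true).card =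
      hammingWeight (fun j : Fin (2 ^ p) => x ⟨j, hl j⟩) +
        (univ.filter fun j : Fin (2 ^ p) =>
          j ≠ ⟨i - 2 ^ p, hi'⟩ ∧ x ⟨2 ^ p + j, hr j⟩ = true).card := by
  have e0 := hammingWeight_eq_card_ne_add x i
  have e1 :=
    hammingWeight_eq_card_ne_add (fun j : Fin (2 ^ p) => x ⟨2 ^ p + j, hr j⟩) ⟨i - 2 ^ p, hi'⟩
  have e2 := hammingWeight_halves p x hl hr
  have hii : (⟨2 ^ p + (i - 2 ^ p), hr ⟨i - 2 ^ p, hi'⟩⟩ : Fin (2 ^ (p + 1))) = i :=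
    Fin.ext (by simp; omega)
  simp only [hii] at e1
  omega

/-- Padding with zeros does not change `|x - xᵢ|`. [folklore] -/
theorem card_ne_pad {n N : ℕ} (hnN : n ≤ N) (x : Fin n → Bool) (x' : Fin N → Bool)
    (hlow : ∀ (j : Fin N) (h : (j : ℕ) < n), x' j = x ⟨j, h⟩)
    (hhigh : ∀ j : Fin N, n ≤ (j : ℕ) → x' j = false) (i : Fin n) :
    (univ.filter fun j : Fin N => j ≠ ⟨i, i.2.trans_le hnN⟩ ∧ x' j = true).card =
      (univ.filter fun j : Fin n => j ≠ i ∧ x j = true).card := by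
  rw [card_filter, card_filter, sum_fin_split (Nat.add_sub_cancel' hnN)]
  have hB : ∑ j : Fin (N - n), (if (⟨n + j, by omega⟩ : Fin N) ≠ ⟨i, i.2.trans_le hnN⟩ ∧
      x' ⟨n + j, by omega⟩ = true then 1 else 0) = 0 :=
    sum_eq_zero fun j _ => by rw [if_neg]; simp [hhigh ⟨n + j, by omega⟩ (by simp)]
  rw [hB, add_zero]
  refine sum_congr rfl fun j _ => ?_
  have hj : x' ⟨j, by omega⟩ = x j := hlow ⟨j, by omega⟩ j.2
  simp only [hj, ne_eq, Fin.ext_iff]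

/-! ### The two networks: sorted blocks (bottom-up) and rank windows (top-down)

For `n = 2ᵖ` variables, `S` sorts every dyadic block (level `r ≤ p`: `2^{p-r}` blocks of `2ʳ`
consecutive variables) — a Batcher sorting network, `≤ p² 2ᵖ` gates — and `T` walks down from
the root: knowing, for the complement `Y` of the current block, the window of ranks
`k - 2^{r} + 1, …, k` of `Y` as the antitone `0`–`1` vector `j ↦ [α ≤ j]` (`α = k - |Y|`
clamped to `[0, 2ʳ]`), it merges the (reversed) window with the zero-padded sorted sibling
block to get the window of each child; at a leaf `i` the window is the single bit
`[α ≤ |x - xᵢ|]`, i.e. `Th_k(x - xᵢ)` for the root window `j ↦ [k ≤ j]`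
(Wegener 1987, proof of Thm. 6.13.3). The levels of `S` are addressed by
`Fin (p + 1) × Fin (2ᵖ)`: entry `(r, s)` is bit `s mod 2ʳ` of the sorted block number
`⌊s / 2ʳ⌋` of level `r`; only the top level `r = p` (the unary code of `|x|`) is specified
explicitly, the lower levels enter the specification of `T` through `S` itself. -/

/-- **The two networks of Wegener's construction** on `2ᵖ` variables (Wegener 1987, proof of
Thm. 6.13.3): a program `S` with `≤ p² 2ᵖ` gates computing all sorted dyadic blocks (top level
`= ` the unary code `s ↦ [s < |x|]`), and a program `T` with `≤ (2p² + 7p) 2ᵖ` gates which, fed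
a window `j ↦ [α ≤ j]` (`α ≤ 2ᵖ`) and the levels `< p` of `S x`, outputs `i ↦ [α ≤ |x - xᵢ|]`;
both over `{∧₂, ∨₂, 0, 1}`. [cite: Wegener1987, Ch. 6 Thm. 13.3] -/
theorem exists_sliceNetworks : ∀ p : ℕ,
    ∃ (S : (Fin (2 ^ p) → Bool) → Fin (p + 1) × Fin (2 ^ p) → Bool)
      (T : (Fin (2 ^ p) ⊕ (Fin p × Fin (2 ^ p)) → Bool) → Fin (2 ^ p) → Bool),
      CktSize monotoneBasis01 S (p * p * 2 ^ p) ∧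
      CktSize monotoneBasis01 T ((2 * p * p + 7 * p) * 2 ^ p) ∧
      (∀ (x : Fin (2 ^ p) → Bool) (s : Fin (2 ^ p)),
          S x (Fin.last p, s) = decide ((s : ℕ) < hammingWeight x)) ∧
      (∀ (x : Fin (2 ^ p) → Bool) (y : Fin (2 ^ p) ⊕ (Fin p × Fin (2 ^ p)) → Bool) (α : ℕ),
          α ≤ 2 ^ p → (∀ j, y (Sum.inl j) = decide (α ≤ (j : ℕ))) →
          (∀ r s, y (Sum.inr (r, s)) = S x (r.castSucc, s)) →
          ∀ i, T y i = decide (α ≤ (univ.filter fun j => j ≠ i ∧ x j = true).card))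
  | 0 => by
    have h1 : ∀ j : Fin (2 ^ 0), j = 0 := fun j => Fin.ext (by simp)
    refine ⟨fun x q => x q.2, fun y i => y (Sum.inl i), ?_, ?_, ?_, ?_⟩
    · exact (CktSize.proj monotoneBasis01 fun q : Fin (0 + 1) × Fin (2 ^ 0) => q.2).of_le
        (Nat.zero_le _)
    · exact (CktSize.proj monotoneBasis01 fun i : Fin (2 ^ 0) =>
        (Sum.inl i : Fin (2 ^ 0) ⊕ (Fin 0 × Fin (2 ^ 0)))).of_le (Nat.zero_le _)
    · intro x s
      have hu : (univ : Finset (Fin (2 ^ 0))) = {s} := by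
        ext j; simp only [mem_univ, mem_singleton, true_iff]; rw [h1 j, h1 s]
      show x s = _
      unfold hammingWeight
      rw [hu, filter_singleton, h1 s]
      by_cases hx : x 0 = true
      · simp [hx]
      · simp [hx]
    · intro x y α _ hyW _ i
      have he : (univ.filter fun j => j ≠ i ∧ x j = true) = ∅ :=
        filter_eq_empty_iff.2 fun j _ hj => hj.1 (by rw [h1 j, h1 i])
      show y (Sum.inl i) = _
      rw [hyW, he, card_empty, h1 i]
      rfl
  | p + 1 => by
    obtain ⟨S, T, hS, hT, hStop, hTspec⟩ := exists_sliceNetworks p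
    -- Batcher's odd–even merge (`OddEvenMerge.lean`), lifted to `{∧₂, ∨₂, 0, 1}`
    obtain ⟨F, hF, hFspec⟩ := exists_oddEvenMerge p
    obtain ⟨G, hG, hGspec⟩ := exists_oddEvenMerge (p + 1)
    replace hF := hF.basis_mono monotoneBasis_subset_monotoneBasis01
    replace hG := hG.basis_mono monotoneBasis_subset_monotoneBasis01
    have h1 : 2 ^ (p + 1) = 2 * 2 ^ p := by ring
    have hp0 : 1 ≤ 2 ^ p := Nat.one_le_two_pow
    have hleft : ∀ j : Fin (2 ^ p), (j : ℕ) < 2 ^ (p + 1) := fun j => by omega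
    have hright : ∀ j : Fin (2 ^ p), 2 ^ p + (j : ℕ) < 2 ^ (p + 1) := fun j => by omega
    -- the two halves of an input vector
    let eL : Fin (2 ^ p) → Fin (2 ^ (p + 1)) := fun j => ⟨j, hleft j⟩
    let eR : Fin (2 ^ p) → Fin (2 ^ (p + 1)) := fun j => ⟨2 ^ p + j, hright j⟩
    /- ─── the sorting network `S'` on `2^{p+1}` variables ─── -/
    let κ1 := (Fin (p + 1) × Fin (2 ^ p)) ⊕ (Fin (p + 1) × Fin (2 ^ p))
    let ρ : Fin (2 ^ p) ⊕ Fin (2 ^ p) → κ1 :=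
      Sum.map (fun s => (Fin.last p, s)) (fun s => (Fin.last p, s))
    have hσ1 : ∀ q : Fin (p + 2) × Fin (2 ^ (p + 1)), min (q.1 : ℕ) p < p + 1 := fun q => by omega
    have hσ2 : ∀ q : Fin (p + 2) × Fin (2 ^ (p + 1)), min (q.2 : ℕ) (2 ^ p - 1) < 2 ^ p :=
      fun q => by omega
    have hσ3 : ∀ q : Fin (p + 2) × Fin (2 ^ (p + 1)), (q.2 : ℕ) - 2 ^ p < 2 ^ p :=
      fun q => by omega
    let σ : Fin (p + 2) × Fin (2 ^ (p + 1)) → κ1 ⊕ Fin (2 ^ (p + 1)) := fun q =>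
      if (q.1 : ℕ) = p + 1 then Sum.inr q.2
      else if (q.2 : ℕ) < 2 ^ p then Sum.inl (Sum.inl (⟨_, hσ1 q⟩, ⟨_, hσ2 q⟩))
      else Sum.inl (Sum.inr (⟨_, hσ1 q⟩, ⟨_, hσ3 q⟩))
    obtain ⟨S', hS'⟩ : ∃ S' : (Fin (2 ^ (p + 1)) → Bool) → Fin (p + 2) × Fin (2 ^ (p + 1)) → Bool,
        ∀ x q, S' x q =
          Sum.elim (Sum.elim (S fun j => x (eL j)) (S fun j => x (eR j)))
            (F fun i => Sum.elim (S fun j => x (eL j)) (S fun j => x (eR j)) (ρ i)) (σ q) :=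
      ⟨_, fun _ _ => rfl⟩
    have hS'top : ∀ x s, S' x (Fin.last (p + 1), s) =
        F (fun i => Sum.elim (S fun j => x (eL j)) (S fun j => x (eR j)) (ρ i)) s := by
      intro x s
      rw [hS']
      simp [σ]
    have hS'low : ∀ x (r : Fin (p + 1)) (s : Fin (2 ^ (p + 1))) (hs : (s : ℕ) < 2 ^ p),
        S' x (r.castSucc, s) = S (fun j => x (eL j)) (r, ⟨s, hs⟩) := by
      intro x r s hs
      rw [hS']
      have hr : ¬ (r : ℕ) = p + 1 := by omega
      have hr' : min (r : ℕ) p = r := by omega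
      have hs' : min (s : ℕ) (2 ^ p - 1) = s := by omega
      simp [σ, hr, hs, hr', hs']
    have hS'high : ∀ x (r : Fin (p + 1)) (s : Fin (2 ^ (p + 1))) (hs : ¬ (s : ℕ) < 2 ^ p),
        S' x (r.castSucc, s) = S (fun j => x (eR j)) (r, ⟨s - 2 ^ p, hσ3 (r.castSucc, s)⟩) := by
      intro x r s hs
      rw [hS']
      have hr : ¬ (r : ℕ) = p + 1 := by omega
      have hr' : min (r : ℕ) p = r := by omega
      simp [σ, hr, hs, hr']
    /- ─── the window network `T'` on `2^{p+1}` variables ─── -/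
    let κ0 := Fin (2 ^ (p + 1)) ⊕ (Fin (p + 1) × Fin (2 ^ (p + 1)))
    let κA := κ0 ⊕ Unit
    let πS : Fin (p + 1) × Fin (2 ^ (p + 1)) → κA := fun q => Sum.inl (Sum.inr q)
    have hρ1 : ∀ s : Fin (2 ^ (p + 1)), 2 ^ p + min (s : ℕ) (2 ^ p - 1) < 2 ^ (p + 1) :=
      fun s => by omega
    have hρ2 : ∀ s : Fin (2 ^ (p + 1)), min (s : ℕ) (2 ^ p - 1) < 2 ^ (p + 1) := fun s => by omega
    have hρ3 : ∀ t : Fin (2 ^ (p + 1)), 2 ^ (p + 1) - 1 - (t : ℕ) < 2 ^ (p + 1) := fun t => by omega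
    -- merge inputs for the LEFT child: the sorted RIGHT half (padded) and the reversed window
    let ρL : Fin (2 ^ (p + 1)) ⊕ Fin (2 ^ (p + 1)) → κA := Sum.elim
      (fun s => if (s : ℕ) < 2 ^ p then Sum.inl (Sum.inr (Fin.last p, ⟨_, hρ1 s⟩)) else Sum.inr ())
      (fun t => Sum.inl (Sum.inl ⟨_, hρ3 t⟩))
    -- merge inputs for the RIGHT child: the sorted LEFT half (padded) and the reversed window
    let ρR : Fin (2 ^ (p + 1)) ⊕ Fin (2 ^ (p + 1)) → κA := Sum.elim
      (fun s => if (s : ℕ) < 2 ^ p then Sum.inl (Sum.inr (Fin.last p, ⟨_, hρ2 s⟩)) else Sum.inr ())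
      (fun t => Sum.inl (Sum.inl ⟨_, hρ3 t⟩))
    let κB := (Fin (p + 1) × Fin (2 ^ (p + 1))) ⊕ (Fin (2 ^ (p + 2)) ⊕ Fin (2 ^ (p + 2)))
    have h4 : 2 ^ (p + 1) ≤ 2 ^ (p + 2) := Nat.pow_le_pow_right (by norm_num) (by omega)
    have hτ : ∀ j : Fin (2 ^ p), 2 ^ (p + 1) - 1 - (j : ℕ) < 2 ^ (p + 2) := fun j => by omega
    let τL : Fin (2 ^ p) ⊕ (Fin p × Fin (2 ^ p)) → κB := Sum.elim
      (fun j => Sum.inr (Sum.inl ⟨_, hτ j⟩)) (fun q => Sum.inl (q.1.castSucc, eL q.2))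
    let τR : Fin (2 ^ p) ⊕ (Fin p × Fin (2 ^ p)) → κB := Sum.elim
      (fun j => Sum.inr (Sum.inr ⟨_, hτ j⟩)) (fun q => Sum.inl (q.1.castSucc, eR q.2))
    let split : Fin (2 ^ (p + 1)) → Fin (2 ^ p) ⊕ Fin (2 ^ p) := fun i =>
      if h : (i : ℕ) < 2 ^ p then Sum.inl ⟨i, h⟩ else Sum.inr ⟨i - 2 ^ p, by omega⟩
    -- the three stages, as functions
    obtain ⟨fA, hfA⟩ : ∃ fA : (κ0 → Bool) → κA → Bool,
        ∀ y, fA y = Sum.elim y (fun _ : Unit => false) := ⟨_, fun _ => rfl⟩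
    obtain ⟨fB, hfB⟩ : ∃ fB : (κA → Bool) → κB → Bool, ∀ z, fB z =
        Sum.elim (fun q => z (πS q)) (Sum.elim (G fun i => z (ρL i)) (G fun i => z (ρR i))) :=
      ⟨_, fun _ => rfl⟩
    obtain ⟨fC, hfC⟩ : ∃ fC : (κB → Bool) → Fin (2 ^ (p + 1)) → Bool, ∀ w i, fC w i =
        Sum.elim (T fun u => w (τL u)) (T fun u => w (τR u)) (split i) := ⟨_, fun _ _ => rfl⟩
    refine ⟨S', fun y => fC (fB (fA y)), ?_, ?_, ?_, ?_⟩
    · -- size of `S'`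
      have h := (((hS.rewire eL).pair (hS.rewire eR)).comp
        ((CktSize.id monotoneBasis01).pair (hF.rewire ρ))).outMap σ
      refine (h.of_le ?_).congr fun x q => (hS' x q).symm
      calc p * p * 2 ^ p + p * p * 2 ^ p + (0 + (p + 1) * 2 ^ (p + 1))
          = (p * p + p + 1) * (2 * 2 ^ p) := by rw [h1]; ring
        _ ≤ ((p + 1) * (p + 1)) * (2 * 2 ^ p) := Nat.mul_le_mul_right _ (by nlinarith)
        _ = (p + 1) * (p + 1) * 2 ^ (p + 1) := by rw [h1]
    · -- size of `T'`
      have hA : CktSize monotoneBasis01 fA (0 + 1) :=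
        ((CktSize.id monotoneBasis01).pair (cktSize_const_mono01 κ0 false)).congr
          fun y u => by rw [hfA]
      have hB : CktSize monotoneBasis01 fB
          (0 + ((p + 1 + 1) * 2 ^ (p + 1 + 1) + (p + 1 + 1) * 2 ^ (p + 1 + 1))) :=
        ((CktSize.proj monotoneBasis01 πS).pair ((hG.rewire ρL).pair (hG.rewire ρR))).congr
          fun z u => by rw [hfB]
      have hC : CktSize monotoneBasis01 fC
          ((2 * p * p + 7 * p) * 2 ^ p + (2 * p * p + 7 * p) * 2 ^ p) :=
        (((hT.rewire τL).pair (hT.rewire τR)).outMap split).congr fun w i => by rw [hfC]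
      refine ((hA.comp hB).comp hC).of_le ?_
      have hY : 2 ^ (p + 1 + 1) = 4 * 2 ^ p := by ring
      rw [h1, hY]
      nlinarith
    · -- top level of `S'` is the unary code of `|x|`
      intro x s
      rw [hS'top, hammingWeight_halves p x hleft hright]
      exact hFspec _ _ _ (hammingWeight_le _) (hammingWeight_le _)
        (fun j => hStop _ j) (fun j => hStop _ j) s
    · -- specification of `T'`
      intro x y α hα hyW hyS i
      have hwL := hammingWeight_le fun j => x (eL j)
      have hwR := hammingWeight_le fun j => x (eR j)
      -- values read through stage A: the reversed window …
      have hAW : ∀ t : Fin (2 ^ (p + 1)), fA y (Sum.inl (Sum.inl ⟨_, hρ3 t⟩)) =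
          decide ((t : ℕ) < 2 ^ (p + 1) - α) := fun t => by
        rw [hfA, Sum.elim_inl, hyW, decide_eq_decide]; simp only; omega
      -- … the padded sorted right half …
      have hAR : ∀ s : Fin (2 ^ (p + 1)), fA y (ρL (Sum.inl s)) =
          decide ((s : ℕ) < hammingWeight fun j => x (eR j)) := fun s => by
        by_cases hs : (s : ℕ) < 2 ^ p
        · simp only [ρL, Sum.elim_inl, hs, ↓reduceIte, hfA]
          rw [hyS, hS'high x (Fin.last p) _
              (by show ¬ 2 ^ p + min (s : ℕ) (2 ^ p - 1) < 2 ^ p; omega),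
            hStop, decide_eq_decide]
          simp only; omega
        · simp only [ρL, Sum.elim_inl, hs, ↓reduceIte, hfA, Sum.elim_inr]
          symm; rw [decide_eq_false_iff_not]; omega
      -- … and the padded sorted left half
      have hAL : ∀ s : Fin (2 ^ (p + 1)), fA y (ρR (Sum.inl s)) =
          decide ((s : ℕ) < hammingWeight fun j => x (eL j)) := fun s => by
        by_cases hs : (s : ℕ) < 2 ^ p
        · simp only [ρR, Sum.elim_inl, hs, ↓reduceIte, hfA]
          rw [hyS, hS'low x (Fin.last p) _ (by show min (s : ℕ) (2 ^ p - 1) < 2 ^ p; omega), hStop,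
            decide_eq_decide]
          simp only; omega
        · simp only [ρR, Sum.elim_inl, hs, ↓reduceIte, hfA, Sum.elim_inr]
          symm; rw [decide_eq_false_iff_not]; omega
      -- the two window merges
      have hZL : ∀ u, G (fun i => fA y (ρL i)) u =
          decide ((u : ℕ) < hammingWeight (fun j => x (eR j)) + (2 ^ (p + 1) - α)) :=
        hGspec _ _ _ (by omega) (by omega) hAR (fun t => hAW t)
      have hZR : ∀ u, G (fun i => fA y (ρR i)) u =
          decide ((u : ℕ) < hammingWeight (fun j => x (eL j)) + (2 ^ (p + 1) - α)) :=
        hGspec _ _ _ (by omega) (by omega) hAL (fun t => hAW t)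
      -- the sorted blocks are passed through
      have hBS : ∀ (r : Fin p) (s : Fin (2 ^ (p + 1))),
          fB (fA y) (Sum.inl (r.castSucc, s)) = S' x (r.castSucc.castSucc, s) := fun r s => by
        rw [hfB, Sum.elim_inl, hfA, Sum.elim_inl, hyS]
      show fC (fB (fA y)) i = _
      rw [hfC]
      by_cases hi : (i : ℕ) < 2 ^ p
      · simp only [split, hi, ↓reduceDIte, Sum.elim_inl]
        rw [hTspec (fun j => x (eL j)) (fun u => fB (fA y) (τL u))
          (min (α - hammingWeight fun j => x (eR j)) (2 ^ p)) (min_le_right _ _)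
          (fun j => by
            show fB (fA y) (Sum.inr (Sum.inl ⟨_, hτ j⟩)) = _
            rw [hfB, Sum.elim_inr, Sum.elim_inl, hZL, decide_eq_decide]
            simp only; omega)
          (fun r s => by
            show fB (fA y) (Sum.inl (r.castSucc, eL s)) = _
            rw [hBS, hS'low x r.castSucc (eL s) s.2])
          ⟨i, hi⟩, card_ne_halves_left p x hleft hright i hi, decide_eq_decide]
        have := card_ne_lt (fun j => x (eL j)) ⟨i, hi⟩
        simp only [eL, eR] at this hwL hwR ⊢
        omega
      · simp only [split, hi, ↓reduceDIte, Sum.elim_inr]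
        rw [hTspec (fun j => x (eR j)) (fun u => fB (fA y) (τR u))
          (min (α - hammingWeight fun j => x (eL j)) (2 ^ p)) (min_le_right _ _)
          (fun j => by
            show fB (fA y) (Sum.inr (Sum.inr ⟨_, hτ j⟩)) = _
            rw [hfB, Sum.elim_inr, Sum.elim_inr, hZR, decide_eq_decide]
            simp only; omega)
          (fun r s => by
            show fB (fA y) (Sum.inl (r.castSucc, eR s)) = _
            rw [hBS, hS'high x r.castSucc (eR s) (by simp [eR])]
            congr 2
            exact Fin.ext (by simp [eR]))
          ⟨i - 2 ^ p, by omega⟩, card_ne_halves_right p x hleft hright i hi (by omega),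
          decide_eq_decide]
        have := card_ne_lt (fun j => x (eR j)) ⟨i - 2 ^ p, by omega⟩
        simp only [eL, eR] at this hwL hwR ⊢
        omega

/-- **All pseudo-complements on `2ᵈ` variables** by one monotone straight-line program with at
most `(3d² + 7d) 2ᵈ + 2` gates over `{∧₂, ∨₂, 0, 1}` (Wegener 1987, Thm. 6.13.3, the case
`n = 2ᵐ` of its proof). [cite: Wegener1987, Ch. 6 Thm. 13.3] -/
theorem pseudoComplements_cktSize_pow (d k : ℕ) :
    CktSize monotoneBasis01
      (fun (x : Fin (2 ^ d) → Bool) (i : Fin (2 ^ d)) => pseudoComplement k i x)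
      ((3 * d * d + 7 * d) * 2 ^ d + 2) := by
  obtain ⟨S, T, hS, hT, -, hTspec⟩ := exists_sliceNetworks d
  -- the root window `j ↦ [k ≤ j]` is a vector of constants
  have hW : CktSize monotoneBasis01
      (fun (_ : Fin (2 ^ d) → Bool) (j : Fin (2 ^ d)) => decide (k ≤ (j : ℕ))) 2 :=
    (cktSize_consts_mono01 (Fin (2 ^ d))).outMap fun j : Fin (2 ^ d) => decide (k ≤ (j : ℕ))
  let g : Fin d × Fin (2 ^ d) → Fin (d + 1) × Fin (2 ^ d) := fun q => (q.1.castSucc, q.2)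
  have h := (hW.pair hS).comp (hT.rewire (Sum.map id g))
  refine (h.of_le (le_of_eq (by ring))).congr fun x i => ?_
  have := hTspec x (fun u => Sum.elim (fun j : Fin (2 ^ d) => decide (k ≤ (j : ℕ))) (S x)
      (Sum.map id g u)) (min k (2 ^ d)) (min_le_right _ _)
    (fun j => by
      show decide (k ≤ (j : ℕ)) = _
      rw [decide_eq_decide]; omega)
    (fun r s => rfl) i
  rw [this]
  unfold pseudoComplement
  rw [decide_eq_decide]
  have := card_ne_lt x i
  omega

/-- The final size estimate: with `d = ⌊log₂ n⌋ + 1` (so `n < 2ᵈ ≤ 2n`) and `n ≥ 2`,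
`(3d² + 7d) 2ᵈ + 3 ≤ 64 · n · ⌊log₂ n⌋²`. [folklore] -/
theorem pseudoComplements_size_le {n : ℕ} (hn : 2 ≤ n) :
    0 + 1 + ((3 * (Nat.log 2 n + 1) * (Nat.log 2 n + 1) + 7 * (Nat.log 2 n + 1)) *
      2 ^ (Nat.log 2 n + 1) + 2) ≤ 64 * (n * Nat.log 2 n ^ 2) := by
  have hL1 : 1 ≤ Nat.log 2 n := Nat.log_pos one_lt_two hn
  have hP : 2 ^ (Nat.log 2 n + 1) ≤ 2 * n := by
    rw [pow_succ]
    have := Nat.pow_log_le_self 2 (show n ≠ 0 by omega)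
    omega
  have hLL : Nat.log 2 n ≤ Nat.log 2 n * Nat.log 2 n := Nat.le_mul_self _
  generalize Nat.log 2 n = L at *
  calc 0 + 1 + ((3 * (L + 1) * (L + 1) + 7 * (L + 1)) * 2 ^ (L + 1) + 2)
      ≤ (3 * (L + 1) * (L + 1) + 7 * (L + 1)) * (2 * n) + 3 := by
        have := Nat.mul_le_mul_left (3 * (L + 1) * (L + 1) + 7 * (L + 1)) hP
        omega
    _ = (6 * (L * L) + 26 * L + 20) * n + 3 := by ring
    _ ≤ (6 * (L * L) + 26 * (L * L) + 20 * (L * L)) * n + 3 * ((L * L) * n) := by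
        have h3 : 1 ≤ (L * L) * n := Nat.one_le_iff_ne_zero.2 (by positivity)
        have : (6 * (L * L) + 26 * L + 20) * n ≤ (6 * (L * L) + 26 * (L * L) + 20 * (L * L)) * n :=
          Nat.mul_le_mul_right _ (by omega)
        omega
    _ = 55 * (n * L ^ 2) := by ring
    _ ≤ 64 * (n * L ^ 2) := Nat.mul_le_mul_right _ (by norm_num)

/-- **Discharge of `pseudoComplements_cktSize`** (Paterson; Wegener 1985; Valiant 1986 — as
stated by Jukna 2012, §10.1.1, p. 300; proof after Wegener 1987, Thm. 6.13.3): for all `n ≥ 2`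
and all `k`, the `n` pseudo-complements `Th_k(x - xᵢ)` are computed by one straight-line
program over `{∧₂, ∨₂, 0, 1}` with at most `64 · n · ⌊log₂ n⌋²` gates. Padding: `x ∈ {0,1}ⁿ`
is embedded into `{0,1}^{2ᵈ}`, `d = ⌊log₂ n⌋ + 1`, by constant-`0` coordinates, which changes
no `|x - xᵢ|`. [cite: Jukna2012, §10.1.1 (PDF p. 300)] -/
theorem pseudoComplements_cktSize_holds : pseudoComplements_cktSize := by
  refine ⟨64, 2, fun n hn k => ?_⟩
  have hnd : n < 2 ^ (Nat.log 2 n + 1) := Nat.lt_pow_succ_log_self one_lt_two n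
  -- pad with zeros up to `2ᵈ` variables
  let emb : Fin (2 ^ (Nat.log 2 n + 1)) → Fin n ⊕ Unit := fun j =>
    if h : (j : ℕ) < n then Sum.inl ⟨j, h⟩ else Sum.inr ()
  have hA : CktSize monotoneBasis01
      (fun (x : Fin n → Bool) => Sum.elim x (fun _ : Unit => false)) (0 + 1) :=
    (CktSize.id monotoneBasis01).pair (cktSize_const_mono01 (Fin n) false)
  have h := (hA.comp ((pseudoComplements_cktSize_pow (Nat.log 2 n + 1) k).rewire emb)).outMap
    fun i : Fin n => (⟨i, i.2.trans hnd⟩ : Fin (2 ^ (Nat.log 2 n + 1)))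
  refine (h.of_le (pseudoComplements_size_le hn)).congr fun x i => ?_
  show pseudoComplement k _ _ = pseudoComplement k i x
  unfold pseudoComplement
  rw [card_ne_pad hnd.le x _ (fun j hj => by simp [emb, hj]) (fun j hj => by
    simp [emb, Nat.not_lt.2 hj]) i]

end Literature.Computability.Complexity
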